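import Summits.HubbardSuperconductivity.HubbardSuperconductivity.Theorems.ChiralWindowCwThesisSectorGroundStateRestrict
import Summits.HubbardSuperconductivity.HubbardSuperconductivity.Theorems.BalabanIRBirGroundStateAverageLRO
import Summits.HubbardSuperconductivity.HubbardSuperconductivity.Theorems.JosephsonMirrorPairBridgeGivesGain
import HarnessLib

/-!
# Route `LogColdTorus`, crux `AverageToEvery` (item `stmt-HubbardSuperconductivity-10519`),
# line `birth`: the block ↔ Fock dictionary (`stub_blockAverageWitness`)

Helper (`--supports`) for the crux
`Summit.HubbardSuperconductivity.HubbardSuperconductivity.Theses.LogColdTorus.AverageToEvery`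
(shared with route `AbelianDuality`), line `birth`, stub `stub_blockAverageWitness`.

**Statement.** At any coupling `U`, any side `L`, any `n` and any `c > 0`: if the tracial
ground-state functional of the compression of `H = hubbardTorus 2 L 1 U` to the `(2n, S^z = 0)`
occupation block `p s := (#s = 2n ∧ 2·#{i ∈ s | spin i = ↑} = 2n)` gives the compressed
`Y = Δ_d† Δ_d` a real part `≥ c L⁴`, then SOME normalised Fock-space sector ground state `ψ`
(`IsGroundStateInSector H (2n) 0 ψ`, `‖ψ‖ = 1`) has `c L⁴ ≤ re ⟨ψ, Y ψ⟩`.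

**Proof.** (a) `c > 0` forces the block index type `{s // p s}` to be non-empty (else the
functional is the junk `0`). (b) The block `B = H.toBlock p p` is Hermitian, so `tr P₀ > 0` for its
ground projection `P₀` and the hypothesis reads `c L⁴ · re tr P₀ ≤ re tr (P₀ O)`, `O = Y.toBlock p p`;
pigeonhole over an orthonormal frame of the block ground space
(`exists_unit_le_re_of_trace_projMatrix_map`) gives a unit block ground vector `φ` with
`c L⁴ ≤ re ⟨φ, O φ⟩`. (c) Extension by zero `ψ` of `φ` lies in `szSector (2n) 0`, the coordinate
subspace of the block (`mem_szSector_two_mul_zero_iff` and the dictionary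
`p s ↔ (#upPart s = n ∧ #downPart s = n)`, via `JosephsonMirror.card_upPart_eq_card_filter`), has
the same norm and the same expectation
(`CwThesis.restrict_dotProduct_of_support`, `CwThesis.toBlock_mulVec_restrict_of_support`), and is
an eigenvector of `H` for the block ground energy (`H` is block diagonal in `(N↑, N↓)`,
`LiebThm1.preservesSectors_hamiltonian`), which is the sector energy
`minEnergyOn H (szSector (2n) 0)` (`CwThesis.groundEnergy_toBlock_eq_minEnergyOn`).
H. Tasaki, *Physics and Mathematics of Quantum Many-Body Systems* (2020) §2.1–2.2; E. H. Lieb,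
PRL 62 (1989) 1201 ("I work in the `S^z = 0` subspace"). Folklore finite-dimensional linear
algebra; no definition and no named fact is introduced.
-/

noncomputable section

-- `dupNamespace`: the summit and the problem are both named `HubbardSuperconductivity` (layout D-0022)
set_option linter.dupNamespace false

namespace Summit.HubbardSuperconductivity.HubbardSuperconductivity.Theorems

open Matrix Finset
open Literature.Probability.LatticeModels Literature.MathematicalPhysics.QuantumLattice
-- `Classical` (scoped, as in the crux file `Theses/LogColdTorus.lean` and the line skeleton): the block
-- index type `{s // p s}` gets its `DecidableEq` instance classically there, and the registered
-- signature below must elaborate to the very same statement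
open scoped ComplexOrder Classical

/-- **The occupation-block dictionary.** A configuration `s` has `2n` electrons of which
`2·#{↑ ∈ s} = 2n` are counted twice as up-spins iff it has `n` up and `n` down electrons
(`#s = #upPart s + #downPart s`, and `#upPart s = #{i ∈ s | spin i = 0}` —
`JosephsonMirror.card_upPart_eq_card_filter`). Lieb, PRL 62 (1989) 1201, proof of Theorem 1.
[folklore] -/
theorem card_block_iff_upPart_downPart {Λ : Type*} [LinearOrder Λ] [Fintype Λ] (n : ℕ)
    (s : Finset (Orb Λ)) :
    (s.card = 2 * n ∧ 2 * (s.filter fun i => (ofLex i).2 = 0).card = 2 * n) ↔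
      ((upPart s).card = n ∧ (downPart s).card = n) := by
  rw [card_eq_upPart_add_downPart s, ← JosephsonMirror.card_upPart_eq_card_filter s]
  omega

/-- **Block ground-state average ⇒ one good sector ground state** (generic form over the
occupation predicate). On the fermionic Fock space of the torus of side `L`, let `H` be Hermitian
and block diagonal in the spin sectors `(N↑, N↓)`, let `p` be a decidable predicate on occupation
sets with `p s ↔ (#upPart s = n ∧ #downPart s = n)`, and let `Y` be any matrix. If `0 < b` and
the tracial ground-state functional of the compression `H.toBlock p p` gives `Y.toBlock p p` a real
part `≥ b`, then some normalised ground state `ψ` of `H` in the joint sector `(2n, S^z = 0)` has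
`b ≤ re ⟨ψ, Y ψ⟩`: the block is non-empty (`b > 0`), pigeonhole over an orthonormal frame of the
block ground space (`exists_unit_le_re_of_trace_projMatrix_map`, `tr P₀ > 0`), and extension by
zero of a block ground vector is a sector ground state with the same norm and expectation
(`mem_szSector_two_mul_zero_iff`, `CwThesis.groundEnergy_toBlock_eq_minEnergyOn`).
Tasaki (2020) §2.1–2.2; Lieb, PRL 62 (1989) 1201. [folklore] -/
theorem exists_groundStateInSector_of_blockAverage (L : ℕ) {n : ℕ}
    (H Y : Matrix (Finset (Orb (FermionTorus 2 L))) (Finset (Orb (FermionTorus 2 L))) ℂ)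
    (hH : H.IsHermitian) (hpres : PreservesSectors H)
    (p : Finset (Orb (FermionTorus 2 L)) → Prop) [DecidablePred p]
    (hdict : ∀ s, p s ↔ ((upPart s).card = n ∧ (downPart s).card = n)) (b : ℝ) (hb : 0 < b)
    (havg : b ≤ ((H.toBlock p p).groundStateFunctional (Y.toBlock p p)).re) :
    ∃ ψ : Fock (Orb (FermionTorus 2 L)),
      IsGroundStateInSector H (2 * n) 0 ψ ∧ star ψ ⬝ᵥ ψ = 1 ∧ b ≤ (star ψ ⬝ᵥ Y *ᵥ ψ).re := by
  -- (a) the block is non-empty: on an empty index type the functional is the junk `0`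
  rcases isEmpty_or_nonempty {s // p s} with hemp | hne
  · exfalso
    have h0 : Y.toBlock p p = 0 := Subsingleton.elim _ _
    rw [h0, map_zero, Complex.zero_re] at havg
    exact absurd havg (not_le.mpr hb)
  -- (b) the block is Hermitian, `tr P₀ > 0`, and the hypothesis reads
  -- `b · re tr P₀ ≤ re tr (P₀ O)`
  have hBh : (H.toBlock p p).IsHermitian := hH.submatrix _
  have htr : 0 < (H.toBlock p p).groundProj.trace := trace_groundProj_pos hBh
  obtain ⟨htr_re, htr_im⟩ := Complex.pos_iff.mp htr
  have hT : (H.toBlock p p).groundProj.trace =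
      (((H.toBlock p p).groundProj.trace.re : ℝ) : ℂ) :=
    Complex.ext (by simp) (by simpa using htr_im.symm)
  rw [Matrix.groundStateFunctional_apply, hT, ← Complex.ofReal_inv, Complex.re_ofReal_mul,
    inv_mul_eq_div, le_div_iff₀ htr_re, Matrix.groundProj_eq] at havg
  -- pigeonhole over an orthonormal frame of the block ground space
  obtain ⟨φ, hφ, hφ1, hφb⟩ := exists_unit_le_re_of_trace_projMatrix_map (H.toBlock p p).groundSpace
    (Matrix.groundSpace_ne_bot_holds hBh) (Y.toBlock p p) b havg
  have hφE : H.toBlock p p *ᵥ φ = (((H.toBlock p p).groundEnergy : ℝ) : ℂ) • φ :=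
    (Matrix.mem_groundSpace_iff _ φ).1 hφ
  -- the block ground energy is the sector energy of the coordinate subspace `szSector (2n) 0`
  -- (`convert`: the block's `DecidableEq` instance is classical here, structural in the cited lemma)
  have hE : (H.toBlock p p).groundEnergy = H.minEnergyOn (szSector (2 * n) 0) := by
    have hK : ∀ v : Fock (Orb (FermionTorus 2 L)),
        v ∈ szSector (Λ := FermionTorus 2 L) (2 * n) 0 ↔ ∀ s, ¬ p s → v s = 0 := fun v => by
      rw [mem_szSector_two_mul_zero_iff n v]
      exact forall_congr' fun s => by rw [hdict s]
    convert CwThesis.groundEnergy_toBlock_eq_minEnergyOn H hH p (szSector (2 * n) 0) hK using 2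
  -- (c) extension by zero
  set ψ : Fock (Orb (FermionTorus 2 L)) := fun s => if h : p s then φ ⟨s, h⟩ else 0 with hψ
  have hψ_apply : ∀ a : {s // p s}, ψ a.1 = φ a := fun a => by simp [hψ, a.2]
  have hψ_not : ∀ s, ¬ p s → ψ s = 0 := fun s hs => by simp [hψ, hs]
  have hres : (fun a : {s // p s} => ψ a.1) = φ := funext hψ_apply
  -- `ψ` lies in the joint sector `(2n, 0)` (it vanishes off the block)
  have hψsec : IsInSector n n ψ := fun s hs => hψ_not s fun h => hs ((hdict s).1 h)
  have hψS : ψ ∈ szSector (2 * n) (0 : ℝ) := (mem_szSector_two_mul_zero_iff n ψ).2 hψsec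
  -- same norm, same expectation
  have hnorm : star ψ ⬝ᵥ ψ = 1 := by
    rw [← CwThesis.restrict_dotProduct_of_support p ψ ψ hψ_not, hres, hφ1]
  have hexp : star ψ ⬝ᵥ Y *ᵥ ψ = star φ ⬝ᵥ Y.toBlock p p *ᵥ φ := by
    rw [← CwThesis.restrict_dotProduct_of_support p ψ (Y *ᵥ ψ) hψ_not,
      ← CwThesis.toBlock_mulVec_restrict_of_support p Y ψ hψ_not, hres]
  have hψ0 : ψ ≠ 0 := by
    intro h
    rw [h, dotProduct_zero] at hnorm
    exact zero_ne_one hnorm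
  -- the eigenvalue equation: on the block `H ψ` restricts to `B φ = E₀ φ`; off the block both
  -- sides vanish (`H` is block diagonal in the spin sectors)
  have hHψ : H *ᵥ ψ = ((H.minEnergyOn (szSector (2 * n) 0) : ℝ) : ℂ) • ψ := by
    funext s
    by_cases hs : p s
    · have h1 : (H *ᵥ ψ) s = (H.toBlock p p *ᵥ fun a : {t // p t} => ψ a.1) ⟨s, hs⟩ := by
        rw [CwThesis.toBlock_mulVec_restrict_of_support p H ψ hψ_not]
      rw [h1, hres, hφE, hE, Pi.smul_apply, Pi.smul_apply, ← hψ_apply ⟨s, hs⟩]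
    · have h2 : (H *ᵥ ψ) s = 0 :=
        (hpres.isInSector_mulVec hψsec) s fun h => hs ((hdict s).2 h)
      rw [h2, Pi.smul_apply, hψ_not s hs, smul_zero]
  refine ⟨ψ, ⟨hψS, hψ0, hHψ⟩, hnorm, ?_⟩
  rw [hexp]
  exact hφb

/-- **STUB 3 `stub_blockAverageWitness` — THE BLOCK ↔ FOCK DICTIONARY** (line `birth` of the crux
`LogColdTorus.AverageToEvery`). At any coupling `U`, any side `L`, any `n` and any `c > 0`: if the
tracial ground-state functional of the compression of `H = hubbardTorus 2 L 1 U` to the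
`(2n, S^z = 0)` occupation block (`#s = 2n`, `2·#{↑ ∈ s} = 2n`) gives the compressed `Δ_d† Δ_d` a
real part `≥ c L⁴`, then SOME normalised sector ground state `ψ` of `H` in the Fock space
(`IsGroundStateInSector H (2n) 0 ψ`, `‖ψ‖ = 1`) has `c L⁴ ≤ re ⟨ψ, Δ_d† Δ_d ψ⟩`: `c > 0` makes the
block non-empty; pigeonhole over an orthonormal frame of the block ground space
(`exists_unit_le_re_of_trace_projMatrix_map`); extension by zero of a block ground vector is a
sector ground state with the same norm and expectation (`szSector (2n) 0` is the coordinate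
subspace of the block, `mem_szSector_two_mul_zero_iff` with `card_block_iff_upPart_downPart`, and
the block ground energy is `minEnergyOn H (szSector (2n) 0)`,
`CwThesis.groundEnergy_toBlock_eq_minEnergyOn`; `H` is Hermitian and block diagonal in
`(N↑, N↓)`). Tasaki (2020) §2.1–2.2; Lieb, PRL 62 (1989) 1201. [folklore] -/
theorem stub_blockAverageWitness :
    ∀ (U c : ℝ) (L n : ℕ) [NeZero L], 0 < c →
      c * (L : ℝ) ^ 4 ≤ (((hubbardTorus 2 L 1 U).toBlock
          (fun s : Finset (Orb (FermionTorus 2 L)) => s.card = 2 * n ∧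
            2 * (s.filter fun i => (ofLex i).2 = 0).card = 2 * n)
          (fun s : Finset (Orb (FermionTorus 2 L)) => s.card = 2 * n ∧
            2 * (s.filter fun i => (ofLex i).2 = 0).card = 2 * n)).groundStateFunctional
          ((((pairField dWaveFormFactor L)ᴴ * pairField dWaveFormFactor L)).toBlock
          (fun s : Finset (Orb (FermionTorus 2 L)) => s.card = 2 * n ∧
            2 * (s.filter fun i => (ofLex i).2 = 0).card = 2 * n)
          (fun s : Finset (Orb (FermionTorus 2 L)) => s.card = 2 * n ∧
            2 * (s.filter fun i => (ofLex i).2 = 0).card = 2 * n))).re →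
      ∃ ψ : Fock (Orb (FermionTorus 2 L)),
        IsGroundStateInSector (hubbardTorus 2 L 1 U) (2 * n) 0 ψ ∧ star ψ ⬝ᵥ ψ = 1 ∧
        c * (L : ℝ) ^ 4 ≤
          (star ψ ⬝ᵥ ((pairField dWaveFormFactor L)ᴴ * pairField dWaveFormFactor L) *ᵥ ψ).re := by
  intro U c L n _ hc havg
  have hL : (0 : ℝ) < L := Nat.cast_pos.mpr (Nat.pos_of_ne_zero (NeZero.ne L))
  exact exists_groundStateInSector_of_blockAverage L (hubbardTorus 2 L 1 U)
    ((pairField dWaveFormFactor L)ᴴ * pairField dWaveFormFactor L)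
    (hubbardTorus_isHermitian (hamiltonian_isHermitian_and_commute_holds _) 1 U)
    (LiebThm1.preservesSectors_hamiltonian (fermionTorusGraph 2 L) 1 U)
    (fun s : Finset (Orb (FermionTorus 2 L)) => s.card = 2 * n ∧
      2 * (s.filter fun i => (ofLex i).2 = 0).card = 2 * n)
    (fun s => card_block_iff_upPart_downPart n s) (c * (L : ℝ) ^ 4) (mul_pos hc (pow_pos hL 4)) havg

end Summit.HubbardSuperconductivity.HubbardSuperconductivity.Theorems

end
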